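import Literature.InformationTheory.QuantumCodes.GF4LinearCodes
import Literature.InformationTheory.QuantumCodes.SymplecticConstructions
import Literature.InformationTheory.QuantumCodes.AdditiveCodeShortening
import HarnessLib

/-!
# Deleting coordinates met evenly: CRSS Lemma 2 and Theorem 7 (`[[n,k,d]] → [[n−m, ≥ k−m, ≥ d]]`) — proved

Source (Calderbank–Rains–Shor–Sloane 1998, §4, printed pp. 13–14; arXiv:quant-ph/9608006 chunks p0014 L31–p0015 L14):
"**Lemma 2.** Let `C` be a linear self-orthogonal code over `GF(4)`. Suppose `S` is a set of coordinates of `C` such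
that every codeword of `C` meets `S` in a vector of even weight. Then the code obtained from `C` by deleting the
coordinates in `S` is also self-orthogonal. *Proof.* Follows from Theorem 4. □  **Theorem 7.** Suppose we have a
linear `[[n, k, d]]` code with associated `(n, 2^{n−k})` code `C`. Then there exists a linear `[[n − m, k′, d′]]`
code with `k′ ≥ k − m` and `d′ ≥ d`, for any `m` such that there exists a codeword of weight `m` in the dual of the
binary code generated by the supports of the codewords of `C`. *Proof.* Let `S` be the support of such a word of
weight `m`. Then `S` satisfies the conditions of the Lemma, and deleting these coordinates gives the desired
code. □"

Formalization (binary symplectic language; the deleted set `S` is taken to be the LAST `m` of `n = l + m`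
coordinates — a word `y` of weight `m` in the dual of the support code with `supp y = S` says exactly that every
codeword meets `S` in even weight; an arbitrary set `T` of `m` coordinates is reduced to this case by the qubit
permutation moving `T` to the end (`permQubits` / `IsAdditiveCode.map_isometry` of `AdditiveCodeShortening.lean`)
in `CRSS1998_theorem7_general`):

* `leftPart l m`, `rightPart l m` (the blocks of `v = (v_T | v_S)`), `deleteLast m S̄ = {v_T : v ∈ S̄}`;
* `CRSS1998_lemma2`: if `S̄` is self-orthogonal and every `v ∈ S̄` has `wt(v_S)` even, then `deleteLast m S̄` is
  self-orthogonal (linearity is not needed for this direction; the even code `{v_S}` is self-orthogonal by Thm. 4);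
* `IsGF4Linear.deleteLast` (deleting coordinates preserves linearity);
* `CRSS1998_theorem7`: for an `[[l+m, k, d]]` code `S̄` all of whose codewords meet the last `m` coordinates evenly,
  and `m < k`: `deleteLast m S̄` is an `[[l, k′, d]]` code for some `k′ ≥ k − m` (linear if `S̄` is, by
  `IsGF4Linear.deleteLast`). The case `k′ = 0` cannot occur under `m < k`.
* `CRSS1998_theorem7_general`: the same for an arbitrary coordinate set `T` with `#T = m` (hypothesis
  `Even #{i ∈ T | v_i ≠ 0}` for all `v ∈ S̄`): `∃ k′ ≥ k − m` and an `[[l, k′, d]]` code, linear if `S̄` is.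

All statements are theorems (no named facts).

## References
* [CalderbankEtAl1998] A. R. Calderbank, E. M. Rains, P. W. Shor, N. J. A. Sloane, *Quantum error correction via
  codes over GF(4)*, IEEE Trans. Inform. Theory 44 (1998) 1369–1387, arXiv:quant-ph/9608006, §4 Lemma 2, Thm. 7.
-/

namespace Literature.InformationTheory.QuantumCodes

open Finset Module

variable {l m : ℕ}

/-! ### Blocks of a vector of length `l + m` -/

/-- The first `l` coordinates `v_T` of `v ∈ Ē_{l+m}`. [cite: CalderbankEtAl1998, §4 Lemma 2 (printed p. 13)] -/
def leftPart (l m : ℕ) : SympVec (l + m) →ₗ[ZMod 2] SympVec l :=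
  (LinearMap.fst (ZMod 2) (SympVec l) (SympVec m)) ∘ₗ
    ((juxtEquiv l m).symm : SympVec (l + m) →ₗ[ZMod 2] (SympVec l × SympVec m))

/-- The last `m` coordinates `v_S` of `v ∈ Ē_{l+m}` (the block to be deleted).
[cite: CalderbankEtAl1998, §4 Lemma 2 (printed p. 13)] -/
def rightPart (l m : ℕ) : SympVec (l + m) →ₗ[ZMod 2] SympVec m :=
  (LinearMap.snd (ZMod 2) (SympVec l) (SympVec m)) ∘ₗ
    ((juxtEquiv l m).symm : SympVec (l + m) →ₗ[ZMod 2] (SympVec l × SympVec m))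

/-- `(u|w)_T = u`. [cite: CalderbankEtAl1998, §4 Lemma 2 (printed p. 13)] -/
@[simp] theorem leftPart_juxt (u : SympVec l) (w : SympVec m) : leftPart l m (juxt u w) = u := by
  rw [leftPart, LinearMap.comp_apply, LinearEquiv.coe_coe, ← juxtEquiv_apply (p := (u, w)),
    LinearEquiv.symm_apply_apply, LinearMap.fst_apply]

/-- `(u|w)_S = w`. [cite: CalderbankEtAl1998, §4 Lemma 2 (printed p. 13)] -/
@[simp] theorem rightPart_juxt (u : SympVec l) (w : SympVec m) : rightPart l m (juxt u w) = w := by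
  rw [rightPart, LinearMap.comp_apply, LinearEquiv.coe_coe, ← juxtEquiv_apply (p := (u, w)),
    LinearEquiv.symm_apply_apply, LinearMap.snd_apply]

/-- `v = (v_T | v_S)`. [cite: CalderbankEtAl1998, §4 Lemma 2 (printed p. 13)] -/
theorem juxt_leftPart_rightPart (v : SympVec (l + m)) : juxt (leftPart l m v) (rightPart l m v) = v :=
  juxt_symm_apply v

/-- Multiplication by `ω` acts coordinatewise, hence blockwise: `ω·(u|w) = (ω·u | ω·w)`.
[cite: CalderbankEtAl1998, §3 (printed p. 10)] -/
theorem omegaMul_juxt (u : SympVec l) (w : SympVec m) :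
    omegaMul (l + m) (juxt u w) = juxt (omegaMul l u) (omegaMul m w) := by
  refine Prod.ext (funext fun i => ?_) (funext fun i => ?_) <;>
  · refine Fin.addCases (fun i => ?_) (fun j => ?_) i <;> simp [juxt]

/-! ### Deleting the last `m` coordinates -/

/-- **The code obtained by deleting the last `m` coordinates**: `{v_T : v ∈ S̄} ≤ Ē_l`.
[cite: CalderbankEtAl1998, §4 Lemma 2 (printed p. 13: "the code obtained from C by deleting the coordinates in S")] -/
def deleteLast (m : ℕ) (S : Submodule (ZMod 2) (SympVec (l + m))) : Submodule (ZMod 2) (SympVec l) :=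
  S.map (leftPart l m)

variable {S : Submodule (ZMod 2) (SympVec (l + m))}

/-- Membership: `u ∈ deleteLast m S̄ ↔ ∃ v ∈ S̄, v_T = u`. [cite: CalderbankEtAl1998, §4 Lemma 2 (printed p. 13)] -/
theorem mem_deleteLast_iff {u : SympVec l} : u ∈ deleteLast m S ↔ ∃ v ∈ S, leftPart l m v = u :=
  Submodule.mem_map

/-- Deleting coordinates preserves linearity. [cite: CalderbankEtAl1998, §4 Thm. 7 (printed p. 14: "a linear [[n − m, k′, d′]] code")] -/
theorem IsGF4Linear.deleteLast (hL : IsGF4Linear S) : IsGF4Linear (deleteLast m S) := by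
  intro u hu
  obtain ⟨v, hv, rfl⟩ := mem_deleteLast_iff.1 hu
  refine mem_deleteLast_iff.2 ⟨omegaMul (l + m) v, hL v hv, ?_⟩
  conv_lhs => rw [← juxt_leftPart_rightPart v, omegaMul_juxt]
  rw [leftPart_juxt]

/-- **CRSS Lemma 2** (last-`m`-coordinates form): if `S̄` is self-orthogonal and every codeword meets the last `m`
coordinates in a vector of even weight, then the code obtained by deleting those coordinates is self-orthogonal —
the right parts form an even code, self-orthogonal by Theorem 4, and `(u,v) = (u_T,v_T) + (u_S,v_S)`.
[cite: CalderbankEtAl1998, §4 Lemma 2 (printed p. 13)] -/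
theorem CRSS1998_lemma2 (hS : IsSelfOrthogonal S) (heven : ∀ v ∈ S, Even (sympWeight (rightPart l m v))) :
    IsSelfOrthogonal (deleteLast m S) := by
  -- the code of right parts is even, hence self-orthogonal
  have hR : IsSelfOrthogonal (S.map (rightPart l m)) := by
    refine CRSS1998_theorem4a fun w hw => ?_
    obtain ⟨v, hv, rfl⟩ := Submodule.mem_map.1 hw
    exact heven v hv
  intro u hu
  rw [mem_sympDual_iff]
  intro u' hu'
  obtain ⟨v, hv, rfl⟩ := mem_deleteLast_iff.1 hu
  obtain ⟨v', hv', rfl⟩ := mem_deleteLast_iff.1 hu'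
  have h0 : sympInner v' v = 0 := mem_sympDual_iff.1 (hS hv) v' hv'
  have h1 : sympInner (rightPart l m v') (rightPart l m v) = 0 :=
    mem_sympDual_iff.1 (hR (Submodule.mem_map_of_mem hv)) _ (Submodule.mem_map_of_mem hv')
  rw [← juxt_leftPart_rightPart v, ← juxt_leftPart_rightPart v', sympInner_juxt, h1, add_zero] at h0
  exact h0

/-- **CRSS Theorem 7** (last-`m`-coordinates form): an `[[l + m, k, d]]` code all of whose codewords meet the last
`m` coordinates evenly (equivalently: the indicator of those coordinates lies in the dual of the binary code
generated by the supports), with `m < k`, yields by deleting them an `[[l, k′, d]]` code with `k′ ≥ k − m`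
(so `d′ ≥ d` in the monotone reading); it is linear when the original code is (`IsGF4Linear.deleteLast`).
[cite: CalderbankEtAl1998, §4 Thm. 7 (printed p. 14)] -/
theorem CRSS1998_theorem7 {k d : ℕ} (h : IsAdditiveCode S k d)
    (heven : ∀ v ∈ S, Even (sympWeight (rightPart l m v))) (hmk : m < k) :
    ∃ k', k - m ≤ k' ∧ IsAdditiveCode (deleteLast m S) k' d := by
  obtain ⟨hSo, hdim, hmin, -⟩ := h
  have hDo : IsSelfOrthogonal (deleteLast m S) := CRSS1998_lemma2 hSo heven
  -- `dim D ≤ dim S̄` and `dim D ≤ l` (self-orthogonal in `Ē_l`)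
  have hDle : finrank (ZMod 2) ↥(deleteLast m S) ≤ finrank (ZMod 2) S := Submodule.finrank_map_le _ _
  have hDl : finrank (ZMod 2) ↥(deleteLast m S) ≤ l := by
    have h2 := finrank_sympDual_add (deleteLast m S)
    have h3 := Submodule.finrank_mono hDo
    omega
  refine ⟨l - finrank (ZMod 2) ↥(deleteLast m S), by omega, hDo, by omega, ?_, fun hk0 => by omega⟩
  -- minimum distance: extend a dual vector by zeros
  intro w' hw' hw'D
  have hw : juxt w' (0 : SympVec m) ∈ sympDual S := by
    rw [mem_sympDual_iff]
    intro v hv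
    rw [← juxt_leftPart_rightPart v, sympInner_juxt, sympInner_comm (rightPart l m v) 0, sympInner_zero_left,
      add_zero]
    exact mem_sympDual_iff.1 hw' _ (Submodule.mem_map_of_mem hv)
  have hwS : juxt w' (0 : SympVec m) ∉ S := fun hmem =>
    hw'D (mem_deleteLast_iff.2 ⟨_, hmem, leftPart_juxt _ _⟩)
  have := hmin _ hw hwS
  rwa [sympWeight_juxt, (sympWeight_eq_zero_iff _).2 rfl, add_zero] at this

/-! ### Arbitrary coordinate sets: reduction to the last block by a qubit permutation -/

/-- Coordinates of the right block: `(v_S)¹_j = v¹_{l+j}`. [cite: CalderbankEtAl1998, §4 Lemma 2 (printed p. 13)] -/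
@[simp] theorem rightPart_fst_apply (v : SympVec (l + m)) (j : Fin m) :
    (rightPart l m v).1 j = v.1 (Fin.natAdd l j) := rfl

/-- Coordinates of the right block: `(v_S)²_j = v²_{l+j}`. [cite: CalderbankEtAl1998, §4 Lemma 2 (printed p. 13)] -/
@[simp] theorem rightPart_snd_apply (v : SympVec (l + m)) (j : Fin m) :
    (rightPart l m v).2 j = v.2 (Fin.natAdd l j) := rfl

/-- Qubit permutations commute with multiplication by `ω` (both act coordinatewise), so they preserve linearity.
[cite: CalderbankEtAl1998, §3 (printed p. 11: the group `G_n`)] -/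
theorem IsGF4Linear.map_permQubits {n : ℕ} {S : Submodule (ZMod 2) (SympVec n)} (hL : IsGF4Linear S)
    (σ : Equiv.Perm (Fin n)) : IsGF4Linear (S.map (permQubits σ : SympVec n →ₗ[ZMod 2] SympVec n)) := by
  intro w hw
  obtain ⟨v, hv, rfl⟩ := Submodule.mem_map.1 hw
  exact Submodule.mem_map.2 ⟨omegaMul n v, hL v hv, rfl⟩

/-- **CRSS Theorem 7** for an arbitrary set `T` of `m` coordinates (out of `l + m`): if every codeword of the
`[[l+m, k, d]]` code `S̄` meets `T` in a vector of even weight (i.e. the indicator word of `T`, of weight `m`, lies in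
the dual of the binary code generated by the supports of the codewords) and `m < k`, then deleting the coordinates
in `T` gives an `[[l, k′, d]]` code with `k′ ≥ k − m`, linear if `S̄` is linear. Reduced to `CRSS1998_theorem7` by
the qubit permutation moving `T` onto the last `m` coordinates (`permQubits`, `IsAdditiveCode.map_isometry`).
[cite: CalderbankEtAl1998, §4 Thm. 7 (printed p. 14)] -/
theorem CRSS1998_theorem7_general {k d : ℕ} (h : IsAdditiveCode S k d) (T : Finset (Fin (l + m)))
    (hT : #T = m) (heven : ∀ v ∈ S, Even #{i ∈ T | v.1 i ≠ 0 ∨ v.2 i ≠ 0}) (hmk : m < k) :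
    ∃ (k' : ℕ) (D : Submodule (ZMod 2) (SympVec l)),
      k - m ≤ k' ∧ IsAdditiveCode D k' d ∧ (IsGF4Linear S → IsGF4Linear D) := by
  classical
  have hcT : Fintype.card {i // i ∈ T} = m := by rw [Fintype.card_coe, hT]
  have hcTc : Fintype.card {i // i ∉ T} = l := by
    rw [Fintype.card_subtype_compl, Fintype.card_fin, hcT, Nat.add_sub_cancel]
  set eT : {i // i ∈ T} ≃ Fin m := Fintype.equivFinOfCardEq hcT
  set eTc : {i // i ∉ T} ≃ Fin l := Fintype.equivFinOfCardEq hcTc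
  set σ : Equiv.Perm (Fin (l + m)) := (Equiv.sumCompl (· ∈ T)).symm.trans
    ((Equiv.sumComm _ _).trans ((eTc.sumCongr eT).trans finSumFinEquiv)) with hσ_def
  have hσsymm : ∀ j : Fin m, σ.symm (Fin.natAdd l j) = (eT.symm j).1 := by
    intro j
    rw [hσ_def]
    simp
  -- the permuted code: same parameters, linear if `S̄` is, and its codewords meet the last block evenly
  set S' := S.map (permQubits σ : SympVec (l + m) →ₗ[ZMod 2] SympVec (l + m)) with hS'_def
  have h' : IsAdditiveCode S' k d := h.map_isometry (isSympIsometry_permQubits σ)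
  have heven' : ∀ w ∈ S', Even (sympWeight (rightPart l m w)) := by
    intro w hw
    obtain ⟨v, hv, rfl⟩ := Submodule.mem_map.1 hw
    have hset : (univ.filter fun j : Fin m =>
        (rightPart l m (permQubits σ v)).1 j ≠ 0 ∨ (rightPart l m (permQubits σ v)).2 j ≠ 0) =
        univ.filter fun j : Fin m => v.1 (eT.symm j).1 ≠ 0 ∨ v.2 (eT.symm j).1 ≠ 0 := by
      refine filter_congr fun j _ => ?_
      rw [rightPart_fst_apply, rightPart_snd_apply]
      change v.1 (σ.symm (Fin.natAdd l j)) ≠ 0 ∨ v.2 (σ.symm (Fin.natAdd l j)) ≠ 0 ↔ _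
      rw [hσsymm]
    have hwt : sympWeight (rightPart l m (permQubits σ v)) = #{i ∈ T | v.1 i ≠ 0 ∨ v.2 i ≠ 0} := by
      unfold sympWeight
      rw [hset]
      refine card_bij (fun j _ => (eT.symm j).1) (fun j hj => ?_) (fun j₁ _ j₂ _ hj => ?_) (fun i hi => ?_)
      · exact mem_filter.2 ⟨(eT.symm j).2, (mem_filter.1 hj).2⟩
      · exact eT.symm.injective (Subtype.ext hj)
      · obtain ⟨hiT, hiP⟩ := mem_filter.1 hi
        refine ⟨eT ⟨i, hiT⟩, mem_filter.2 ⟨mem_univ _, ?_⟩, ?_⟩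
        · rw [Equiv.symm_apply_apply]; exact hiP
        · rw [Equiv.symm_apply_apply]
    show Even (sympWeight (rightPart l m (permQubits σ v)))
    rw [hwt]
    exact heven v hv
  obtain ⟨k', hk', hD⟩ := CRSS1998_theorem7 h' heven' hmk
  exact ⟨k', deleteLast m S', hk', hD, fun hL => (hL.map_permQubits σ).deleteLast⟩

end Literature.InformationTheory.QuantumCodes
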